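import Summits.Ventures.CertifiedManyBodySolver.Theorems.TcThermcert1FreeGasCanonicalPullThrough
import Summits.Ventures.CertifiedManyBodySolver.Theorems.TcThermcert1FreeGasSectorBounds
import HarnessLib

/-!
# Free canonical gas at `β·t = 8` — S5: the exact pull-through at complex fugacity (resummed, one leg; current form)

Helper file for route `TcThermcert1` (crux K1′ `ThermalStiffnessCeilingU8b8_le_7o44`, item `stmt-Ventures-24560`), crux idea
`free-canonical-b8-rung` (card `Cruxes/ThermalStiffnessCeilingU8b10_le_1o8/Ideas/free-canonical-b8-rung.md`, sketch
`Cruxes/ThermalStiffnessCeilingU8b10_le_1o8/FreeCanonicalB8Sketch.lean`). The critic's verdict (hubbard-floor-crit-1 g11, §5.1) names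
two untyped assembly steps of the saddle-free scheme; the first is the **complex-fugacity Wick pull-through of a current leg into the
support of the insertion**. This file TYPES AND PROVES its exact algebraic content.

Setting: a quadratic Hamiltonian `dΓ(h)` on the Fock space over `Orb Λ = Λ × {↑,↓}` with spin-block-diagonal one-body Gibbs factor
`E = e^{−βh}` (spin-`σ` block `E_σ`), a "twist" `D` and a scalar `ζ` with `ζ D c_{xσ} = c_{xσ} D` for all sites `x` — the intended
instance is the complex two-fugacity weight `D = diag(z^{N↑} w^{N↓})` with `ζ = z` (spin ↑) / `ζ = w` (spin ↓) (§1). Write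
`T(O) = tr(D e^{−βdΓ(h)} O)`. The tree's one-step identity (`trace_P_succ_mul_gibbsWeight_dGamma_mul`, Gaudin pull-through + CAR +
cyclicity, valid for ANY intertwined pair) gives the linear system (§2)

  `(1 + ζE_σ) F = ζ E_σ S`,  `F(x) = T(A c†_p c_{xσ})`,  `S(y) = [yσ = p] T(A) + T([c_{yσ}, A] c†_p)`,

and hence, for every LEFT INVERSE `G'` of `1 + ζE_σ` (it exists off the finitely many poles `ζ = −1/κ`, `κ ∈ spec E_σ`), the
**resummed pull-through** `T(A c†_p c_{xσ}) = Σ_y G_ζ(x,y) S(y)` with the complex-fugacity Fermi kernel `G_ζ = ζ G' E_σ = ζE_σ(1+ζE_σ)⁻¹`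
(§3) — the fixed-`ζ` replacement of the tree's divergent-at-low-temperature alternating expansion
(`trace_P_mul_gibbsWeight_dGamma_mul_expansion`). §4: for the bond CURRENT `j_σ = −i c†_{aσ}c_{bσ} + i c†_{bσ}c_{aσ}` the `T(A)` terms
cancel when `G_ζ(a,b) = G_ζ(b,a)`, leaving only commutator terms supported on `supp A`:
`T(A j_σ) = i Σ_y ( G_ζ(a,y) T([c_{yσ},A] c†_{bσ}) − G_ζ(b,y) T([c_{yσ},A] c†_{aσ}) )`.

What is NOT here (the critic's "norm control"): bounds on the entries of `G_ζ` on the good arc (sketch stub S4, Combes–Thomas) and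
on the twisted traces `T([c_{yσ},A] c†)` with insertion (the conditional Gaussian domination, stub S6 — the named residual of the card).

HONEST LABEL: finite-dimensional algebra; a step of a RUNG (`U = 0`, BC5-type witness for the C8 bet), reach at `U = 8` ZERO; decides
nothing about K1/K1′/`T_c`; superconductivity in the Hubbard model is NOT proved or advanced by this file beyond the rung.
-/

noncomputable section

namespace Summit.Ventures.CertifiedManyBodySolver.Theorems.TcThermcert1.FreeCanonicalB8

open NormedSpace Matrix Finset
open Literature.MathematicalPhysics.QuantumLattice
open Summit.Ventures.CertifiedManyBodySolver.Theorems.TcThermcert1.FreeGasCurrentClustering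
open scoped ComplexOrder

variable {Λ : Type*} [LinearOrder Λ] [Fintype Λ]

/-! ## §1 The two-fugacity weight is intertwined by the annihilators -/

/-- `z · diag(z^{N↑} w^{N↓}) · c_{x↑} = c_{x↑} · diag(z^{N↑} w^{N↓})`: removing an up electron lowers `N↑` by one. -/
theorem fugacityDiagonal_intertwine_up {inst : DecidableEq (Finset (Orb Λ))} (z w : ℂ) (x : Λ) :
    (z • @diagonal _ ℂ inst _ (fun s : Finset (Orb Λ) => z ^ (upPart s).card * w ^ (downPart s).card)) *
        annihilation (orb x 0) =
      annihilation (orb x 0) *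
        @diagonal _ ℂ inst _ (fun s : Finset (Orb Λ) => z ^ (upPart s).card * w ^ (downPart s).card) := by
  ext s u
  rw [Matrix.smul_mul, Matrix.smul_apply, diagonal_mul, mul_diagonal, annihilation_apply, smul_eq_mul]
  by_cases hxu : orb x 0 ∉ s ∧ u = insert (orb x 0) s
  · rw [if_pos hxu]
    obtain ⟨hx, rfl⟩ := hxu
    obtain ⟨α, γ, rfl⟩ : ∃ α γ, s = pairSet α γ := ⟨upPart s, downPart s, (pairSet_upPart_downPart s).symm⟩
    rw [orb_zero_mem_pairSet] at hx
    rw [pairSet_insert_zero, upPart_pairSet, downPart_pairSet, upPart_pairSet, downPart_pairSet,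
      Finset.card_insert_of_notMem hx, pow_succ]
    ring
  · rw [if_neg hxu, mul_zero, zero_mul, mul_zero]

/-- `w · diag(z^{N↑} w^{N↓}) · c_{x↓} = c_{x↓} · diag(z^{N↑} w^{N↓})`: removing a down electron lowers `N↓` by one. -/
theorem fugacityDiagonal_intertwine_down {inst : DecidableEq (Finset (Orb Λ))} (z w : ℂ) (x : Λ) :
    (w • @diagonal _ ℂ inst _ (fun s : Finset (Orb Λ) => z ^ (upPart s).card * w ^ (downPart s).card)) *
        annihilation (orb x 1) =
      annihilation (orb x 1) *
        @diagonal _ ℂ inst _ (fun s : Finset (Orb Λ) => z ^ (upPart s).card * w ^ (downPart s).card) := by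
  ext s u
  rw [Matrix.smul_mul, Matrix.smul_apply, diagonal_mul, mul_diagonal, annihilation_apply, smul_eq_mul]
  by_cases hxu : orb x 1 ∉ s ∧ u = insert (orb x 1) s
  · rw [if_pos hxu]
    obtain ⟨hx, rfl⟩ := hxu
    obtain ⟨α, γ, rfl⟩ : ∃ α γ, s = pairSet α γ := ⟨upPart s, downPart s, (pairSet_upPart_downPart s).symm⟩
    rw [orb_one_mem_pairSet] at hx
    rw [pairSet_insert_one, upPart_pairSet, downPart_pairSet, upPart_pairSet, downPart_pairSet,
      Finset.card_insert_of_notMem hx, pow_succ]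
    ring
  · rw [if_neg hxu, mul_zero, zero_mul, mul_zero]

/-! ## §2 The linear system `(1 + ζE_σ) F = ζ E_σ S` -/

/-- **One-step identity at complex fugacity.** If `ζ D c_{xσ} = c_{xσ} D` for all `x` and `E = e^{−βh}` is spin-block-diagonal with
spin-`σ` block `E_σ`, then for every operator `A`, orbital `p` and site `x`, with `T(O) = tr(D e^{−βdΓ(h)} O)`:
`T(A c†_p c_{xσ}) + ζ Σ_y E_σ(x,y) T(A c†_p c_{yσ}) = ζ Σ_y E_σ(x,y) ( [yσ = p] T(A) + T([c_{yσ},A] c†_p) )`. -/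
theorem fugacity_pullThrough_step (β : ℝ) (h : Matrix (Orb Λ) (Orb Λ) ℂ)
    (hE : ∀ q k : Orb Λ, (ofLex q).2 ≠ (ofLex k).2 → (exp (-((β : ℂ) • h))) q k = 0) (σ : Fin 2)
    (D : Matrix (Finset (Orb Λ)) (Finset (Orb Λ)) ℂ) (ζ : ℂ)
    (hD : ∀ x : Λ, (ζ • D) * annihilation (orb x σ) = annihilation (orb x σ) * D)
    (Eσ : Matrix Λ Λ ℂ) (hEσ : ∀ x y : Λ, Eσ x y = (exp (-((β : ℂ) • h))) (orb x σ) (orb y σ))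
    (A : Matrix (Finset (Orb Λ)) (Finset (Orb Λ)) ℂ) (p : Orb Λ) (x : Λ) :
    (D * gibbsWeight β (dGamma h) * (A * (creation p * annihilation (orb x σ)))).trace +
        ζ * ∑ y : Λ, Eσ x y * (D * gibbsWeight β (dGamma h) * (A * (creation p * annihilation (orb y σ)))).trace =
      ζ * ∑ y : Λ, Eσ x y *
        ((if orb y σ = p then (D * gibbsWeight β (dGamma h) * A).trace else 0) +
          (D * gibbsWeight β (dGamma h) * ((annihilation (orb y σ) * A - A * annihilation (orb y σ)) * creation p)).trace) := by
  have h1 := trace_P_succ_mul_gibbsWeight_dGamma_mul β h hE σ (ζ • D) D x (hD x) A p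
  rw [h1]
  simp only [smul_mul_assoc, Matrix.trace_smul, smul_eq_mul, ← hEσ]
  rw [Finset.mul_sum, Finset.mul_sum, ← Finset.sum_add_distrib]
  refine Finset.sum_congr rfl fun y _ => ?_
  split_ifs <;> ring

/-! ## §3 The resummed pull-through with the complex-fugacity Fermi kernel `G_ζ = ζ G' E_σ`, `G' (1 + ζE_σ) = 1` -/

/-- **Resummed complex-fugacity pull-through (one leg).** Under the hypotheses of `fugacity_pullThrough_step`, for every left inverse
`G'` of `1 + ζE_σ`: `T(A c†_p c_{xσ}) = Σ_y G_ζ(x,y) ( [yσ = p] T(A) + T([c_{yσ},A] c†_p) )`, `G_ζ = ζ G' E_σ`. For `A` even and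
supported away from `y` the commutator `[c_{yσ}, A]` vanishes, so the sum localises on `supp A ∪ {p}`. -/
theorem fugacity_pullThrough (β : ℝ) (h : Matrix (Orb Λ) (Orb Λ) ℂ)
    (hE : ∀ q k : Orb Λ, (ofLex q).2 ≠ (ofLex k).2 → (exp (-((β : ℂ) • h))) q k = 0) (σ : Fin 2)
    (D : Matrix (Finset (Orb Λ)) (Finset (Orb Λ)) ℂ) (ζ : ℂ)
    (hD : ∀ x : Λ, (ζ • D) * annihilation (orb x σ) = annihilation (orb x σ) * D)
    (Eσ : Matrix Λ Λ ℂ) (hEσ : ∀ x y : Λ, Eσ x y = (exp (-((β : ℂ) • h))) (orb x σ) (orb y σ))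
    (G' : Matrix Λ Λ ℂ) (hG' : G' * (1 + ζ • Eσ) = 1)
    (A : Matrix (Finset (Orb Λ)) (Finset (Orb Λ)) ℂ) (p : Orb Λ) (x : Λ) :
    (D * gibbsWeight β (dGamma h) * (A * (creation p * annihilation (orb x σ)))).trace =
      ∑ y : Λ, (ζ • (G' * Eσ)) x y *
        ((if orb y σ = p then (D * gibbsWeight β (dGamma h) * A).trace else 0) +
          (D * gibbsWeight β (dGamma h) * ((annihilation (orb y σ) * A - A * annihilation (orb y σ)) * creation p)).trace) := by
  set W := gibbsWeight β (dGamma h) with hW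
  -- the unknown vector `F` and the source vector `S`
  set Fv : Λ → ℂ := fun y => (D * W * (A * (creation p * annihilation (orb y σ)))).trace with hFv
  set Sv : Λ → ℂ := fun y => (if orb y σ = p then (D * W * A).trace else 0) +
    (D * W * ((annihilation (orb y σ) * A - A * annihilation (orb y σ)) * creation p)).trace with hSv
  -- §2 in matrix–vector form
  have hvec : (1 + ζ • Eσ) *ᵥ Fv = ζ • (Eσ *ᵥ Sv) := by
    funext x'
    have hx' := fugacity_pullThrough_step β h hE σ D ζ hD Eσ hEσ A p x'
    rw [← hW] at hx'
    rw [Matrix.add_mulVec, Matrix.one_mulVec, Matrix.smul_mulVec, Pi.add_apply, Pi.smul_apply, Pi.smul_apply, smul_eq_mul,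
      smul_eq_mul]
    simp only [Matrix.mulVec, dotProduct, hFv, hSv]
    exact hx'
  -- apply the left inverse
  have hF : Fv = (ζ • (G' * Eσ)) *ᵥ Sv := by
    calc Fv = (G' * (1 + ζ • Eσ)) *ᵥ Fv := by rw [hG', Matrix.one_mulVec]
      _ = G' *ᵥ ((1 + ζ • Eσ) *ᵥ Fv) := by rw [Matrix.mulVec_mulVec]
      _ = G' *ᵥ (ζ • (Eσ *ᵥ Sv)) := by rw [hvec]
      _ = (ζ • (G' * Eσ)) *ᵥ Sv := by rw [Matrix.mulVec_smul, Matrix.mulVec_mulVec, ← Matrix.smul_mulVec]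
  have hx := congrFun hF x
  simp only [hFv, hSv, Matrix.mulVec, dotProduct] at hx
  exact hx

/-! ## §4 The bond current: cancellation of the `T(A)` terms -/

/-- **Current form of the complex-fugacity pull-through.** Under the hypotheses of `fugacity_pullThrough`, if the kernel
`G_ζ = ζ G' E_σ` is symmetric on the pair `(a, b)` then for every operator `A`
`T(A j_σ) = i Σ_y ( G_ζ(a,y) T([c_{yσ},A] c†_{bσ}) − G_ζ(b,y) T([c_{yσ},A] c†_{aσ}) )`, `j_σ = −i c†_{aσ} c_{bσ} + i c†_{bσ} c_{aσ}`:
the sector-blind `T(A)·G_ζ(a,b)` terms cancel (time reversal), only commutator terms supported on `supp A` remain. -/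
theorem fugacity_pullThrough_current (β : ℝ) (h : Matrix (Orb Λ) (Orb Λ) ℂ)
    (hE : ∀ q k : Orb Λ, (ofLex q).2 ≠ (ofLex k).2 → (exp (-((β : ℂ) • h))) q k = 0) (σ : Fin 2)
    (D : Matrix (Finset (Orb Λ)) (Finset (Orb Λ)) ℂ) (ζ : ℂ)
    (hD : ∀ x : Λ, (ζ • D) * annihilation (orb x σ) = annihilation (orb x σ) * D)
    (Eσ : Matrix Λ Λ ℂ) (hEσ : ∀ x y : Λ, Eσ x y = (exp (-((β : ℂ) • h))) (orb x σ) (orb y σ))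
    (G' : Matrix Λ Λ ℂ) (hG' : G' * (1 + ζ • Eσ) = 1)
    (A : Matrix (Finset (Orb Λ)) (Finset (Orb Λ)) ℂ) (a b : Λ)
    (hsymm : (ζ • (G' * Eσ)) a b = (ζ • (G' * Eσ)) b a) :
    (D * gibbsWeight β (dGamma h) *
        (A * ((-Complex.I) • (creation (orb a σ) * annihilation (orb b σ)) + Complex.I • (creation (orb b σ) * annihilation (orb a σ))))).trace =
      Complex.I * ∑ y : Λ,
        ((ζ • (G' * Eσ)) a y *
            (D * gibbsWeight β (dGamma h) * ((annihilation (orb y σ) * A - A * annihilation (orb y σ)) * creation (orb b σ))).trace -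
          (ζ • (G' * Eσ)) b y *
            (D * gibbsWeight β (dGamma h) * ((annihilation (orb y σ) * A - A * annihilation (orb y σ)) * creation (orb a σ))).trace) := by
  set W := gibbsWeight β (dGamma h) with hW
  have hlin : (D * W * (A * ((-Complex.I) • (creation (orb a σ) * annihilation (orb b σ)) +
      Complex.I • (creation (orb b σ) * annihilation (orb a σ))))).trace =
      (-Complex.I) * (D * W * (A * (creation (orb a σ) * annihilation (orb b σ)))).trace +
        Complex.I * (D * W * (A * (creation (orb b σ) * annihilation (orb a σ)))).trace := by
    rw [Matrix.mul_add, Matrix.mul_smul, Matrix.mul_smul, Matrix.mul_add, Matrix.mul_smul, Matrix.mul_smul, Matrix.trace_add,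
      Matrix.trace_smul, Matrix.trace_smul, smul_eq_mul, smul_eq_mul]
  rw [hlin, hW, fugacity_pullThrough β h hE σ D ζ hD Eσ hEσ G' hG' A (orb a σ) b,
    fugacity_pullThrough β h hE σ D ζ hD Eσ hEσ G' hG' A (orb b σ) a, ← hW]
  -- the `[y = a]` / `[y = b]` terms
  have hδ : ∀ (u v : Λ), ∑ y : Λ, (ζ • (G' * Eσ)) u y *
      ((if orb y σ = orb v σ then (D * W * A).trace else 0) +
        (D * W * ((annihilation (orb y σ) * A - A * annihilation (orb y σ)) * creation (orb v σ))).trace) =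
      (ζ • (G' * Eσ)) u v * (D * W * A).trace +
        ∑ y : Λ, (ζ • (G' * Eσ)) u y *
          (D * W * ((annihilation (orb y σ) * A - A * annihilation (orb y σ)) * creation (orb v σ))).trace := by
    intro u v
    rw [← Finset.sum_add_distrib.symm.trans (Finset.sum_congr rfl fun y _ => (mul_add _ _ _).symm)]
    congr 1
    rw [Finset.sum_eq_single v]
    · rw [if_pos rfl]
    · intro y _ hy
      rw [if_neg (fun h' => hy (orb_inj.1 h').1), mul_zero]
    · intro hv; exact absurd (Finset.mem_univ v) hv
  rw [hδ b a, hδ a b, hsymm, Finset.sum_sub_distrib]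
  ring

end Summit.Ventures.CertifiedManyBodySolver.Theorems.TcThermcert1.FreeCanonicalB8

end
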